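import Summits.QuantumFields.BalabanUV.T4Continuum.Support.CovariantBlockAveragingTower
import Summits.QuantumFields.BalabanUV.T4Continuum.Support.LineAveragingPairing
import Summits.QuantumFields.BalabanUV.T4Continuum.Support.GramPerturbationLaw

/-!
# T⁴ programme, spine node NE2 (U1a), tier B row B3.b-conc (iii) — THE TWO-LEVEL PAIRING OF THE TRANSPORT ERROR
# `E_k = √(n_k^d)·(Q_k(R_k) − Q_k ⊗ 1)` against King's planting: `‖E_{k+1}(J_k ⊗ 1) − E_k‖ ≤ card o·(θ + τ·L^{−k})`
# from the two-level consistency `θ` of the CONTOUR TRANSPORTERS (row B3.b-conc (ii), a HYPOTHESIS here) and their size `τ`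

NE2 formalisation swarm `b2b-balaban-t4-ne2-formalise-*`, leaf prover 07 (rows B3.a / B3.a′, split (ii)/(iii) of B3.b-conc agreed
with leaf-06, CLAIMS l.5680/l.5999/l.6068).  Companion of `Support/CovariantBlockAveraging` (`Qcov`, `transport`, `contour`) and
`Support/CovariantBlockAveragingTower` (`Bfree`, `Ecov`); uses leaf-06's `Support/LineAveragingPairing` (`glue`, `par_bpt_glue_add_tstep`,
`tent_count`, `sum_fun_coord`, `cL`).

THE MECHANISM (two levels `n ← L·n`, direction `μ`, unit block `y`).  A fine pair `(j′, t′)` = (block offset `L·j + r`, line position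
`t′`) of the `(L·n)`-lattice is planted by `J_L` on the COARSE pair `(j, ⌊(r_μ + t′)/L⌋)` (`par_bpt_glue_add_tstep`): the fine straight
contour starts at the fine point, `r_μ` fine steps AFTER the coarse point, so the `L²·L^{d−1}` fine pairs over a coarse pair are the
interior ones, while weight `L(L−1)/2·L^{d−1}` is transferred from the first coarse bond `s = 0` to the bond `s = n` AFTER the coarse
contour (`tent_count`).  Hence, ENTRYWISE (`pairing_apply`),
`(√(L^d)·(Q′(R′) − Q′⊗1)(J_L ⊗ 1) − (Q(R) − Q⊗1))((y,μ),α)((x,μ),α′) = n^{−(d+1)}·[ L^{−(d+1)} Σ_{j,r,t′} 𝟙[x = ny+j+s e_μ]·(T′_{j,r,t′} − T_{j,s})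
  + c_L·Σ_j (𝟙[x = ny+j+n e_μ](T_{j,n} − 1) − 𝟙[x = ny+j](T_{j,0} − 1)) ]_{αα′}`, `s = ⌊(r_μ + t′)/L⌋`, `c_L = (L−1)/(2L)`,
with `T′`, `T` the contour transporters of `CovariantBlockAveraging.contour` at the two levels.  The first bracket is the TWO-LEVEL
CONSISTENCY of the transporters (hypothesis `θ`, row B3.b-conc (ii) — for Bałaban's backgrounds NE3's `LocalRate` currency, c2), the
second the END-OF-LINE term (size `τ` of the transporters, B3.a).  THIS FILE proves the identity (`pairD`, `pairing_apply`); the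
companion `Support/CovariantBlockAveragingPairingLaw` takes norms (Schur: rows `θ + τ/n`, columns `n^{−d}(θ + τ/n)`, colour factor
`card o`), giving `‖√((Ln)^d)·(Q′(R′) − Q′⊗1)(J_L ⊗ 1) − √(n^d)·(Q(R) − Q⊗1)‖ ≤ card o·(θ + τ/n)` and, along the tower, the `E`-datum
`AveragingLaws (k ↦ calDalev k ⊗ₖ 1) (Ecov L M R) (k ↦ JpcT k ⊗ₖ 1) ε (k ↦ Cst·card o·(θ k + τ·L^{−k}))` of the owner's Gram law.

HONEST FRAMING (T4-DAG p. 1).  Exact lattice bookkeeping + Schur bounds about the TYPED operators of the companion files; the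
transporters are DATA and their two-level consistency `θ` is a HYPOTHESIS (row B3.b-conc (ii); for Bałaban's `U_k(V)` it is NE3's
content, consumed by name — nothing here asserts it); no B0; constants OURS and symbolic; finite torus, linear layer, operator norm;
NOT NE2, NOT [B9] (3.23)–(3.26) as printed, NOT infinite volume / mass gap / Clay; spine 0/9 unchanged.  HONEST DEPENDENCY: continuum
YM on T⁴ ⇐ BetaPertH ∧ nine spine estimates (0/9 proved); BetaPertH ⇐ (D1) ∧ (D4) ∧ CAP+tail; G-an2-4 gates asym, D1 and NE2/3/4.
ABSOLUTE RULE kept; no `sorry`.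
-/

noncomputable section

open scoped BigOperators ComplexConjugate Matrix Matrix.Norms.L2Operator Kronecker
open Finset

namespace Summit.QuantumFields.BalabanUV.T4Continuum.CovariantBlockAveraging

open Literature.MathematicalPhysics.QuantumFieldTheory.Balaban1983to89.B5Prop11Plancherel (Tor fine unitVec Cst Cst_nonneg)
open Literature.MathematicalPhysics.QuantumFieldTheory.Balaban1983to89.B5Block118 (QvOp bpt tstep tstep_zero)
open Literature.MathematicalPhysics.QuantumFieldTheory.Balaban1983to89.B5G183RateUnitTower (lev lev_neZero)
open Literature.MathematicalPhysics.QuantumFieldTheory.Balaban1983to89.Beta.DeltaACombesThomas (sum_blocks_ite)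
open Summit.QuantumFields.BalabanUV.T4Continuum.BalabanAveragedTowerUnit (idx norm_entry_le_opNorm one_le_lev' cast_lev')
open Summit.QuantumFields.BalabanUV.T4Continuum.BalabanAveragedTowerModes (par)
open Summit.QuantumFields.BalabanUV.T4Continuum.KingPairingPlantedLaw (JK JpcT calDalev calDalev_inv opNorm_inv_calDalev_le sqrt_facts)
open Summit.QuantumFields.BalabanUV.T4Continuum.BlockPairingGeometry (parT JK_apply)
open Summit.QuantumFields.BalabanUV.T4Continuum.LineAveragingPairing (glue sum_glue par_bpt_glue_add_tstep tent_count sum_fun_coord cL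
  norm_cL_le)
open Summit.QuantumFields.BalabanUV.T4Continuum.GramPerturbationLaw (AveragingLaws)
open Summit.QuantumFields.BalabanUV.T4Continuum.KroneckerLift

variable {d : ℕ}

/-! ## §1 Products with the lifted planting `J_L ⊗ 1` -/

section TwoLevel

variable (n L : ℕ) [NeZero n] [NeZero L] (M : Fin d → ℕ) [hM : ∀ μ, NeZero (M μ)] {o : Type*} [Fintype o] [DecidableEq o]

/-- the CONTOUR TRANSPORTER at level `N`: transport along `contour N M y j μ t`. [folklore] -/
abbrev ctr (N : ℕ) [NeZero N] (R : Fin d → (Tor (fine N M) × Fin d → Matrix o o ℂ)) (y : Tor M) (j : Fin d → Fin N) (μ : Fin d)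
    (t : ℕ) : Matrix o o ℂ :=
  transport (fine N M) R μ (contour N M y j μ t)

/-- entries of `X·(J_L ⊗ 1)`: `(X(J_L ⊗ 1))(b, (i, α′)) = √(L^d)·L^{−d}·Σ_{i′ : parT i′ = i} X(b, (i′, α′))`. [folklore] -/
theorem mul_JK_kron_apply {σ : Type*} (X : Matrix σ ((Tor (fine (L * n) M) × Fin d) × o) ℂ) (b : σ)
    (i : Tor (fine n M) × Fin d) (α' : o) :
    (X * (JK n L M ⊗ₖ (1 : Matrix o o ℂ))) b (i, α')
      = (((Real.sqrt ((L : ℝ) ^ d)) : ℝ) : ℂ) * ((L : ℂ) ^ d)⁻¹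
          * ∑ i' : Tor (fine (L * n) M) × Fin d, (if parT n L M i' = i then X b (i', α') else 0) := by
  rw [Matrix.mul_apply, Fintype.sum_prod_type, Finset.mul_sum]
  refine Finset.sum_congr rfl fun i' _ => ?_
  rw [Finset.sum_eq_single α']
  · rw [Matrix.kroneckerMap_apply, Matrix.one_apply_eq, mul_one, JK_apply]
    split_ifs <;> ring
  · intro α'' _ hne
    rw [Matrix.kroneckerMap_apply, Matrix.one_apply_ne hne, mul_zero, mul_zero]
  · intro h; exact absurd (Finset.mem_univ _) h

/-- **THE TWO-LEVEL PAIRING MATRIX** `D = √(L^d)·(Q′(R′) − Q′ ⊗ 1)(J_L ⊗ 1) − (Q(R) − Q ⊗ 1)` (unscaled by `√(n^d)`). [folklore] -/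
def pairD (R' : Fin d → (Tor (fine (L * n) M) × Fin d → Matrix o o ℂ)) (R : Fin d → (Tor (fine n M) × Fin d → Matrix o o ℂ)) :
    Matrix ((Tor M × Fin d) × o) ((Tor (fine n M) × Fin d) × o) ℂ :=
  (((Real.sqrt ((L : ℝ) ^ d)) : ℝ) : ℂ) • ((Qcov (L * n) M (contour (L * n) M) R' - QvOp (L * n) M ⊗ₖ (1 : Matrix o o ℂ))
      * (JK n L M ⊗ₖ (1 : Matrix o o ℂ)))
    - (Qcov n M (contour n M) R - QvOp n M ⊗ₖ (1 : Matrix o o ℂ))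

/-! ## §2 The entry identity -/

/-- the FINE transport error planted on the coarse lattice, entrywise, BEFORE re-indexing:
`Σ_{i′: parT i′ = i} (Q′(R′) − Q′⊗1)(b,(i′,α′)) = [i.2 = μ]·Σ_{j′,t′} 𝟙[par(L·n·y + j′ + t′e_μ) = i.1]·(L n)^{−(d+1)}·(T′ − 1)_{αα′}`. [folklore] -/
theorem sum_parT_sub_kron_apply (R' : Fin d → (Tor (fine (L * n) M) × Fin d → Matrix o o ℂ)) (b : (Tor M × Fin d) × o)
    (i : Tor (fine n M) × Fin d) (α' : o) :
    ∑ i' : Tor (fine (L * n) M) × Fin d,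
        (if parT n L M i' = i then (Qcov (L * n) M (contour (L * n) M) R' - QvOp (L * n) M ⊗ₖ (1 : Matrix o o ℂ)) b (i', α') else 0)
      = if i.2 = b.1.2 then
          ∑ j' : Fin d → Fin (L * n), ∑ t' : Fin (L * n),
            (if par n L M (bpt (L * n) M b.1.1 j' + tstep (fine (L * n) M) b.1.2 t') = i.1 then
              (1 / (((L * n : ℕ)) : ℂ) ^ (d + 1)) * (ctr M (L * n) R' b.1.1 j' b.1.2 t' - 1) b.2 α' else 0)
        else 0 := by
  -- rewrite each entry as a double sum of point indicators
  have hX : ∀ i' : Tor (fine (L * n) M) × Fin d,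
      (Qcov (L * n) M (contour (L * n) M) R' - QvOp (L * n) M ⊗ₖ (1 : Matrix o o ℂ)) b (i', α')
        = ∑ j' : Fin d → Fin (L * n), ∑ t' : Fin (L * n),
            (if i' = (bpt (L * n) M b.1.1 j' + tstep (fine (L * n) M) b.1.2 t', b.1.2) then
              (1 / (((L * n : ℕ)) : ℂ) ^ (d + 1)) * (ctr M (L * n) R' b.1.1 j' b.1.2 t' - 1) b.2 α' else 0) := by
    intro i'
    rw [Qcov_sub_kron_apply]
    by_cases h : i'.2 = b.1.2
    · rw [if_pos h]
      push_cast
      refine Finset.sum_congr rfl fun j' _ => Finset.sum_congr rfl fun t' _ => ?_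
      have hiff : i' = (bpt (L * n) M b.1.1 j' + tstep (fine (L * n) M) b.1.2 t', b.1.2)
          ↔ i'.1 = bpt (L * n) M b.1.1 j' + tstep (fine (L * n) M) b.1.2 t' :=
        ⟨fun hi => by rw [hi], fun hi => Prod.ext hi h⟩
      by_cases hc : i'.1 = bpt (L * n) M b.1.1 j' + tstep (fine (L * n) M) b.1.2 t'
      · rw [if_pos hc, if_pos (hiff.mpr hc)]
      · rw [if_neg hc, if_neg (fun h' => hc (hiff.mp h'))]
    · rw [if_neg h]
      symm
      refine Finset.sum_eq_zero fun j' _ => Finset.sum_eq_zero fun t' _ => if_neg ?_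
      intro hi; exact h (by rw [hi])
  simp_rw [hX]
  -- exchange the sums and evaluate the point indicator
  have hswap : ∑ i' : Tor (fine (L * n) M) × Fin d, (if parT n L M i' = i then
      ∑ j' : Fin d → Fin (L * n), ∑ t' : Fin (L * n),
        (if i' = (bpt (L * n) M b.1.1 j' + tstep (fine (L * n) M) b.1.2 t', b.1.2) then
          (1 / (((L * n : ℕ)) : ℂ) ^ (d + 1)) * (ctr M (L * n) R' b.1.1 j' b.1.2 t' - 1) b.2 α' else 0) else 0)
      = ∑ j' : Fin d → Fin (L * n), ∑ t' : Fin (L * n),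
          (if parT n L M (bpt (L * n) M b.1.1 j' + tstep (fine (L * n) M) b.1.2 t', b.1.2) = i then
            (1 / (((L * n : ℕ)) : ℂ) ^ (d + 1)) * (ctr M (L * n) R' b.1.1 j' b.1.2 t' - 1) b.2 α' else 0) := by
    have e : ∀ i' : Tor (fine (L * n) M) × Fin d, (if parT n L M i' = i then
        ∑ j' : Fin d → Fin (L * n), ∑ t' : Fin (L * n),
          (if i' = (bpt (L * n) M b.1.1 j' + tstep (fine (L * n) M) b.1.2 t', b.1.2) then
            (1 / (((L * n : ℕ)) : ℂ) ^ (d + 1)) * (ctr M (L * n) R' b.1.1 j' b.1.2 t' - 1) b.2 α' else 0) else 0)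
        = ∑ j' : Fin d → Fin (L * n), ∑ t' : Fin (L * n),
          (if i' = (bpt (L * n) M b.1.1 j' + tstep (fine (L * n) M) b.1.2 t', b.1.2) then
            (if parT n L M (bpt (L * n) M b.1.1 j' + tstep (fine (L * n) M) b.1.2 t', b.1.2) = i then
              (1 / (((L * n : ℕ)) : ℂ) ^ (d + 1)) * (ctr M (L * n) R' b.1.1 j' b.1.2 t' - 1) b.2 α' else 0) else 0) := by
      intro i'
      by_cases hp : parT n L M i' = i
      · rw [if_pos hp]
        refine Finset.sum_congr rfl fun j' _ => Finset.sum_congr rfl fun t' _ => ?_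
        by_cases hi : i' = (bpt (L * n) M b.1.1 j' + tstep (fine (L * n) M) b.1.2 t', b.1.2)
        · rw [if_pos hi, if_pos hi, ← hi, if_pos hp]
        · rw [if_neg hi, if_neg hi]
      · rw [if_neg hp]
        symm
        refine Finset.sum_eq_zero fun j' _ => Finset.sum_eq_zero fun t' _ => ?_
        by_cases hi : i' = (bpt (L * n) M b.1.1 j' + tstep (fine (L * n) M) b.1.2 t', b.1.2)
        · rw [if_pos hi, ← hi, if_neg hp]
        · rw [if_neg hi]
    simp_rw [e]
    rw [Finset.sum_comm]
    refine Finset.sum_congr rfl fun j' _ => ?_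
    rw [Finset.sum_comm]
    refine Finset.sum_congr rfl fun t' _ => ?_
    rw [Finset.sum_ite_eq' Finset.univ]
    simp
  rw [hswap]
  by_cases h : i.2 = b.1.2
  · rw [if_pos h]
    refine Finset.sum_congr rfl fun j' _ => Finset.sum_congr rfl fun t' _ => ?_
    have hiff : parT n L M (bpt (L * n) M b.1.1 j' + tstep (fine (L * n) M) b.1.2 t', b.1.2) = i
        ↔ par n L M (bpt (L * n) M b.1.1 j' + tstep (fine (L * n) M) b.1.2 t') = i.1 := by
      rw [parT]
      constructor
      · intro hi; rw [← hi]
      · intro hi; exact Prod.ext hi h.symm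
    simp only [hiff]
  · rw [if_neg h]
    refine Finset.sum_eq_zero fun j' _ => Finset.sum_eq_zero fun t' _ => if_neg ?_
    intro hi
    exact h (by rw [← hi]; rfl)

/-- after GLUING the fine offset `j′ = L·j + r`: the planted fine pair `(L·j + r, t′)` sits over the coarse point
`n·y + j + ⌊(r_μ + t′)/L⌋ e_μ`. [folklore] -/
theorem sum_parT_sub_kron_apply_glue (R' : Fin d → (Tor (fine (L * n) M) × Fin d → Matrix o o ℂ)) (b : (Tor M × Fin d) × o)
    (i : Tor (fine n M) × Fin d) (α' : o) :
    ∑ i' : Tor (fine (L * n) M) × Fin d,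
        (if parT n L M i' = i then (Qcov (L * n) M (contour (L * n) M) R' - QvOp (L * n) M ⊗ₖ (1 : Matrix o o ℂ)) b (i', α') else 0)
      = if i.2 = b.1.2 then
          ∑ j : Fin d → Fin n, ∑ r : Fin d → Fin L, ∑ t' : Fin (L * n),
            (if bpt n M b.1.1 j + tstep (fine n M) b.1.2 (((r b.1.2 : ℕ) + t') / L) = i.1 then
              (1 / (((L * n : ℕ)) : ℂ) ^ (d + 1)) * (ctr M (L * n) R' b.1.1 (glue n L (j, r)) b.1.2 t' - 1) b.2 α' else 0)
        else 0 := by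
  rw [sum_parT_sub_kron_apply]
  split_ifs
  · rw [sum_glue]
    refine Finset.sum_congr rfl fun j _ => Finset.sum_congr rfl fun r _ => Finset.sum_congr rfl fun t' _ => ?_
    rw [par_bpt_glue_add_tstep]
  · rfl

/-- the real scalar `√(L^d)` times `√(L^d)·L^{−d}` is `1`. [folklore] -/
theorem sqrt_mul_consts : (((Real.sqrt ((L : ℝ) ^ d)) : ℝ) : ℂ) * ((((Real.sqrt ((L : ℝ) ^ d)) : ℝ) : ℂ) * ((L : ℂ) ^ d)⁻¹) = 1 := by
  have hLc : ((L : ℂ) ^ d) ≠ 0 := pow_ne_zero _ (by exact_mod_cast NeZero.ne L)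
  obtain ⟨_, hss⟩ := sqrt_facts (d := d) L
  rw [← mul_assoc, hss, mul_inv_cancel₀ hLc]

/-- sums over offset vectors of a function of one coordinate, division-free in the form used below:
`Σ_r φ(r_μ) = L^{d−1}·Σ_ρ φ(ρ)`. [folklore] -/
theorem sum_fun_coord' (μ : Fin d) (φ : Fin L → ℂ) :
    ∑ r : Fin d → Fin L, φ (r μ) = (L : ℂ) ^ (d - 1) * ∑ ρ : Fin L, φ ρ := by
  have hL : (L : ℂ) ≠ 0 := by exact_mod_cast NeZero.ne L
  have h2 : (L : ℂ) ^ d = (L : ℂ) * (L : ℂ) ^ (d - 1) := by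
    rw [← pow_succ']; congr 1; have := Fin.pos μ; omega
  have h := sum_fun_coord L μ φ
  rw [h2, mul_assoc] at h
  exact mul_left_cancel₀ hL h

omit [NeZero n] in
/-- **THE TENT COUNT applied to the coarse transporters**: for each coarse offset `j`,
`Σ_r Σ_{t′<Ln} 𝟙[x = ny+j+s e_μ](T_{j,s} − 1) = L^{d+1}·Σ_{s<n} 𝟙[…](T_{j,s} − 1) + L^{d+1}c_L·(Φ_j(n) − Φ_j(0))`, `s = ⌊(r_μ + t′)/L⌋`.
[folklore] -/
theorem tent_transport (Φ : ℕ → ℂ) (μ : Fin d) :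
    ∑ r : Fin d → Fin L, ∑ t' : Fin (L * n), Φ (((r μ : ℕ) + t') / L)
      = (L : ℂ) ^ (d + 1) * ∑ s : Fin n, Φ s + (L : ℂ) ^ (d + 1) * cL L * (Φ n - Φ 0) := by
  have hL : 0 < L := Nat.pos_of_ne_zero (NeZero.ne L)
  have hLc : (L : ℂ) ≠ 0 := by exact_mod_cast hL.ne'
  have hd : d + 1 = (d - 1) + 2 := by have := Fin.pos μ; omega
  have hcL : (∑ ρ ∈ range L, (ρ : ℂ)) = (L : ℂ) ^ 2 * cL L := by
    rw [cL]; field_simp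
  have e1 : ∀ r : Fin d → Fin L, ∑ t' : Fin (L * n), Φ (((r μ : ℕ) + t') / L) = ∑ t ∈ range (L * n), Φ (((r μ : ℕ) + t) / L) :=
    fun r => Fin.sum_univ_eq_sum_range (fun t => Φ (((r μ : ℕ) + t) / L)) (L * n)
  simp_rw [e1]
  rw [sum_fun_coord' L μ (fun ρ : Fin L => ∑ t ∈ range (L * n), Φ (((ρ : ℕ) + t) / L)),
    Fin.sum_univ_eq_sum_range (fun ρ => ∑ t ∈ range (L * n), Φ ((ρ + t) / L)) L, tent_count Φ L n hL,
    ← Fin.sum_univ_eq_sum_range (fun s => Φ s) n, hcL, hd, pow_add]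
  ring

/-- **THE ENTRY IDENTITY** of the two-level pairing (see the module docstring): consistency part + end-of-line part. [folklore] -/
theorem pairing_apply (R' : Fin d → (Tor (fine (L * n) M) × Fin d → Matrix o o ℂ)) (R : Fin d → (Tor (fine n M) × Fin d → Matrix o o ℂ))
    (b : (Tor M × Fin d) × o) (i : Tor (fine n M) × Fin d) (α' : o) :
    pairD n L M R' R b (i, α')
    = if i.2 = b.1.2 then
        (1 / (n : ℂ) ^ (d + 1)) *
          ((1 / (L : ℂ) ^ (d + 1)) *
              ∑ j : Fin d → Fin n, ∑ r : Fin d → Fin L, ∑ t' : Fin (L * n),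
                (if bpt n M b.1.1 j + tstep (fine n M) b.1.2 (((r b.1.2 : ℕ) + t') / L) = i.1 then
                  (ctr M (L * n) R' b.1.1 (glue n L (j, r)) b.1.2 t' - ctr M n R b.1.1 j b.1.2 (((r b.1.2 : ℕ) + t') / L)) b.2 α'
                 else 0)
            + cL L * ∑ j : Fin d → Fin n,
                ((if bpt n M b.1.1 j + tstep (fine n M) b.1.2 n = i.1 then (ctr M n R b.1.1 j b.1.2 n - 1) b.2 α' else 0)
                 - (if bpt n M b.1.1 j + tstep (fine n M) b.1.2 0 = i.1 then (ctr M n R b.1.1 j b.1.2 0 - 1) b.2 α' else 0)))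
      else 0 := by
  have hL : 0 < L := Nat.pos_of_ne_zero (NeZero.ne L)
  have hLc : (L : ℂ) ≠ 0 := by exact_mod_cast hL.ne'
  have hnc : (n : ℂ) ≠ 0 := by exact_mod_cast NeZero.ne n
  rw [pairD, Matrix.sub_apply, Matrix.smul_apply, smul_eq_mul, mul_JK_kron_apply, sum_parT_sub_kron_apply_glue, Qcov_sub_kron_apply]
  by_cases h : i.2 = b.1.2
  · simp only [if_pos h]
    rw [← mul_assoc, sqrt_mul_consts, one_mul]
    -- name the coarse indicator-weighted transporter entries
    set Φ : (Fin d → Fin n) → ℕ → ℂ := fun j s =>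
      if bpt n M b.1.1 j + tstep (fine n M) b.1.2 s = i.1 then (ctr M n R b.1.1 j b.1.2 s - 1) b.2 α' else 0 with hΦ
    -- the coarse side in terms of Φ
    have hcoarse : ∑ j : Fin d → Fin n, ∑ t : Fin n,
        (if i.1 = bpt n M b.1.1 j + tstep (fine n M) b.1.2 t then
          (1 / (n : ℂ) ^ (d + 1)) * (transport (fine n M) R b.1.2 (contour n M b.1.1 j b.1.2 t) - 1) b.2 α' else 0)
        = (1 / (n : ℂ) ^ (d + 1)) * ∑ j : Fin d → Fin n, ∑ s : Fin n, Φ j s := by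
      rw [Finset.mul_sum]
      refine Finset.sum_congr rfl fun j _ => ?_
      rw [Finset.mul_sum]
      refine Finset.sum_congr rfl fun s _ => ?_
      simp only [hΦ, eq_comm (a := i.1)]
      split_ifs <;> simp
    -- the fine side: split `T′ − 1 = (T′ − T) + (T − 1)` and apply the tent count to the second part
    have hfine : ∑ j : Fin d → Fin n, ∑ r : Fin d → Fin L, ∑ t' : Fin (L * n),
        (if bpt n M b.1.1 j + tstep (fine n M) b.1.2 (((r b.1.2 : ℕ) + t') / L) = i.1 then
          (1 / (((L * n : ℕ)) : ℂ) ^ (d + 1)) * (ctr M (L * n) R' b.1.1 (glue n L (j, r)) b.1.2 t' - 1) b.2 α' else 0)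
        = (1 / (((L * n : ℕ)) : ℂ) ^ (d + 1)) *
          (∑ j : Fin d → Fin n, ∑ r : Fin d → Fin L, ∑ t' : Fin (L * n),
              (if bpt n M b.1.1 j + tstep (fine n M) b.1.2 (((r b.1.2 : ℕ) + t') / L) = i.1 then
                (ctr M (L * n) R' b.1.1 (glue n L (j, r)) b.1.2 t' - ctr M n R b.1.1 j b.1.2 (((r b.1.2 : ℕ) + t') / L)) b.2 α'
               else 0)
            + ∑ j : Fin d → Fin n, ((L : ℂ) ^ (d + 1) * ∑ s : Fin n, Φ j s + (L : ℂ) ^ (d + 1) * cL L * (Φ j n - Φ j 0))) := by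
      rw [mul_add, Finset.mul_sum, Finset.mul_sum, ← Finset.sum_add_distrib]
      refine Finset.sum_congr rfl fun j _ => ?_
      rw [← tent_transport n L (Φ j) b.1.2, ← mul_add, ← Finset.sum_add_distrib, Finset.mul_sum]
      refine Finset.sum_congr rfl fun r _ => ?_
      rw [← Finset.sum_add_distrib, Finset.mul_sum]
      refine Finset.sum_congr rfl fun t' _ => ?_
      simp only [hΦ]
      split_ifs
      · rw [Matrix.sub_apply, Matrix.sub_apply, Matrix.sub_apply]; ring
      · simp
    rw [hfine, hcoarse]
    have hD : ∀ j : Fin d → Fin n,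
        ((if bpt n M b.1.1 j + tstep (fine n M) b.1.2 n = i.1 then (ctr M n R b.1.1 j b.1.2 n - 1) b.2 α' else 0)
          - (if bpt n M b.1.1 j + tstep (fine n M) b.1.2 0 = i.1 then (ctr M n R b.1.1 j b.1.2 0 - 1) b.2 α' else 0))
          = Φ j n - Φ j 0 := fun j => rfl
    simp only [hD]
    rw [Finset.sum_add_distrib, ← Finset.mul_sum, ← Finset.mul_sum]
    set A := ∑ j : Fin d → Fin n, ∑ r : Fin d → Fin L, ∑ t' : Fin (L * n),
      (if bpt n M b.1.1 j + tstep (fine n M) b.1.2 (((r b.1.2 : ℕ) + t') / L) = i.1 then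
        (ctr M (L * n) R' b.1.1 (glue n L (j, r)) b.1.2 t' - ctr M n R b.1.1 j b.1.2 (((r b.1.2 : ℕ) + t') / L)) b.2 α'
        else 0) with hA
    set S := ∑ j : Fin d → Fin n, ∑ s : Fin n, Φ j s with hS
    set D := ∑ j : Fin d → Fin n, (Φ j n - Φ j 0) with hD'
    push_cast
    field_simp
    ring
  · simp only [if_neg h, mul_zero, sub_zero]

end TwoLevel

end Summit.QuantumFields.BalabanUV.T4Continuum.CovariantBlockAveraging

end
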